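/-
Copyright (c) 2026 the pub-hodgecm-mathlib formalisation cell (harness21).  Prover seat hodgecm-mathlib-K2Liu-p11 (g2), Track B «K2-LIT»,
#184♮ = hLiu418 = `stmt-HodgeConjecture-24832`; A7-val road (σ), V6-inst (LEAD F0P6-plan (g14) BATCH #13 (1): «K2Liu-p11 ⇒ (σ) V6-inst NOW»;
K2Liu-p09 (g6) 12:24:52Z (d): the binder `hBcont` of ★ V8d `K2LiuA7ValueFace.exists_average` ∕ ★ V6b).  THEOREMS ONLY (no `def`, no `instance`, no notation,
no named-fact hypothesis, no `sorry`).
-/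
import Summits.HodgeConjecture.HodgeConjecture.Theorems.K2LiuSWSectionKPrimeAverage         -- ★ (A4-avg) §3 `eventually_leviOp_eq_self`, `isOpen_setOf_leviOp_eq_self`
import HarnessLib

/-!
# Crux `HLiu418`, A7-val (σ), V6-inst (first letter): THE COEFFICIENTS `g ↦ B (leviEquivSB (ρ g) Φ) h` OF THE LEVI ACTION ON `𝒮(F^ι)` ARE LOCALLY CONSTANT,
# HENCE CONTINUOUS — the binder `hBcont` of ★ V8d `exists_average` ∕ ★ V6b `exists_kPrimeAverage_exports`, discharged generically

Cell `hodgecm-mathlib`, crux item hLiu418 = `stmt-HodgeConjecture-24832` (helper lane `--supports`, count-neutral).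

For a topological group `Γ` acting on `X = F^ι` (`F` a non-archimedean local field) through a POINTWISE-CONTINUOUS `ρ : Γ →* GL(F^ι)` (`∀ u, Continuous (γ ↦ ρ γ u)`):
every `Φ ∈ 𝒮(F^ι)` has an OPEN stabiliser (★ (A4-avg) §3 `isOpen_setOf_leviOp_eq_self` — the action on `𝒮` is smooth), so the orbit map `γ ↦ leviEquivSB (ρ γ) Φ` is
LOCALLY CONSTANT, and so is every coefficient `γ ↦ L (leviEquivSB (ρ γ) Φ)` for any map `L` out of `𝒮(F^ι)` — in particular `γ ↦ B (leviEquivSB (ρ γ) Φ) h` is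
continuous for every section-valued `B : 𝒮(F^ι) →ₗ[ℂ] (H → ℂ)`: **`continuous_coeff_leviEquivSB`** = the binder `hBcont` VERBATIM.  At the instance `Γ = G = U(V′_v)`,
`ρ = 1 ⊗ g` on `X_{Δ,B} ≅ F_v^ι`, the pointwise continuity `hρ` is the continuity of matrix multiplication (V8-inst's one line).
* `leviEquivSB_eq_of_mem_stab` (orbit map constant on left cosets of the stabiliser), `isLocallyConstant_leviEquivSB` (orbit map), `isLocallyConstant_coeff_leviEquivSB`
  (any coefficient), **`continuous_coeff_leviEquivSB`** (`hBcont`), `continuous_coeff_leviEquivSB_apply` (scalar-valued `L : 𝒮 →ₗ[ℂ] ℂ`).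
References: [MoeglinVignerasWaldspurger1987, Chap. 2 II.6, II.8 (smooth vectors of the Weil representation)]; [BernsteinZelevinsky1976, §2].
HONEST LABEL: HC_CM is proved only modulo the 7 printed citations (2 remaining named inputs: hLiu418 = stmt-HodgeConjecture-24832,
h413 = stmt-HodgeConjecture-24833) until rung 0 closes; count-neutral helper, closes no socket.
-/

set_option autoImplicit false
set_option linter.dupNamespace false

noncomputable section

open Filter Topology
open Literature.NumberTheory.Automorphic Literature.RepresentationTheory.HeisenbergGroup

namespace Summit.HodgeConjecture.HodgeConjecture.Cruxes.HLiu418.K2LiuLeviActionSmoothCoeff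

open Summit.HodgeConjecture.HodgeConjecture.Cruxes.HLiu418.K2LiuSWSectionKPrimeAverage

variable {F : Type*} [Field F] [ValuativeRel F] [TopologicalSpace F] [IsNonarchimedeanLocalField F]
  {ι : Type*} [Fintype ι] [DecidableEq ι]
  {Γ : Type*} [Group Γ] [TopologicalSpace Γ] [IsTopologicalGroup Γ]

omit [ValuativeRel F] [IsNonarchimedeanLocalField F] [Fintype ι] [DecidableEq ι] [TopologicalSpace Γ] [IsTopologicalGroup Γ] in
/-- The orbit map is constant on `γ₀ · Stab(Φ)`: `leviOp (ρ s) Φ = Φ ⇒ leviEquivSB (ρ (γ₀ s)) Φ = leviEquivSB (ρ γ₀) Φ`.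
[MoeglinVignerasWaldspurger1987, Chap. 2 II.8] -/
theorem leviEquivSB_eq_of_mem_stab (ρ : Γ →* ((ι → F) ≃ₗ[F] (ι → F))) (hρc : ∀ γ, Continuous (ρ γ)) (hρc' : ∀ γ, Continuous (ρ γ).symm)
    (Φ : SchwartzBruhat (ι → F)) {γ₀ s : Γ} (hs : leviOp (ρ s) (Φ : (ι → F) → ℂ) = Φ) :
    leviEquivSB (ρ (γ₀ * s)) (hρc (γ₀ * s)) (hρc' (γ₀ * s)) Φ = leviEquivSB (ρ γ₀) (hρc γ₀) (hρc' γ₀) Φ := by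
  apply Subtype.ext
  rw [coe_leviEquivSB, coe_leviEquivSB, map_mul, leviOp_mul, LinearEquiv.mul_apply, hs]

omit [DecidableEq ι] in
/-- **THE ORBIT MAP `γ ↦ leviEquivSB (ρ γ) Φ` IS LOCALLY CONSTANT** for a pointwise-continuous `ρ` (the stabiliser is open, ★ `isOpen_setOf_leviOp_eq_self`).
[MoeglinVignerasWaldspurger1987, Chap. 2 II.8] [BernsteinZelevinsky1976, §2] -/
theorem isLocallyConstant_leviEquivSB (ρ : Γ →* ((ι → F) ≃ₗ[F] (ι → F))) (hρ : ∀ u, Continuous fun γ => ρ γ u) (hρc : ∀ γ, Continuous (ρ γ))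
    (hρc' : ∀ γ, Continuous (ρ γ).symm) (Φ : SchwartzBruhat (ι → F)) :
    IsLocallyConstant fun γ : Γ => leviEquivSB (ρ γ) (hρc γ) (hρc' γ) Φ := by
  classical
  rw [IsLocallyConstant.iff_eventually_eq]
  intro γ₀
  -- the translated stabiliser `γ₀ · Stab(Φ)` is a neighbourhood of `γ₀`
  have hS : IsOpen {γ : Γ | leviOp (ρ γ) (Φ : (ι → F) → ℂ) = Φ} := isOpen_setOf_leviOp_eq_self ρ hρ Φ
  have hmem : (fun γ : Γ => γ₀⁻¹ * γ) ⁻¹' {γ : Γ | leviOp (ρ γ) (Φ : (ι → F) → ℂ) = Φ} ∈ 𝓝 γ₀ := by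
    refine (continuous_const_mul γ₀⁻¹).continuousAt.preimage_mem_nhds (hS.mem_nhds ?_)
    show leviOp (ρ (γ₀⁻¹ * γ₀)) (Φ : (ι → F) → ℂ) = Φ
    rw [inv_mul_cancel, map_one, leviOp_one]
    rfl
  filter_upwards [hmem] with γ hγ
  have h := leviEquivSB_eq_of_mem_stab ρ hρc hρc' Φ (γ₀ := γ₀) (s := γ₀⁻¹ * γ) hγ
  simp only [mul_inv_cancel_left] at h
  exact h

omit [DecidableEq ι] in
/-- **EVERY COEFFICIENT OF THE ORBIT MAP IS LOCALLY CONSTANT**: for any map `L` out of `𝒮(F^ι)` (linear functional, section-valued functional, …).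
[MoeglinVignerasWaldspurger1987, Chap. 2 II.8] -/
theorem isLocallyConstant_coeff_leviEquivSB {W : Type*} (ρ : Γ →* ((ι → F) ≃ₗ[F] (ι → F))) (hρ : ∀ u, Continuous fun γ => ρ γ u)
    (hρc : ∀ γ, Continuous (ρ γ)) (hρc' : ∀ γ, Continuous (ρ γ).symm) (Φ : SchwartzBruhat (ι → F)) (L : SchwartzBruhat (ι → F) → W) :
    IsLocallyConstant fun γ : Γ => L (leviEquivSB (ρ γ) (hρc γ) (hρc' γ) Φ) :=
  (isLocallyConstant_leviEquivSB ρ hρ hρc hρc' Φ).comp L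

omit [DecidableEq ι] in
/-- **`hBcont` OF ★ V8d `exists_average` ∕ ★ V6b**: for every section-valued linear `B : 𝒮(F^ι) →ₗ[ℂ] (H → ℂ)`, every `Φ` and `h`, the coefficient
`γ ↦ B (leviEquivSB (ρ γ) Φ) h` is CONTINUOUS (indeed locally constant). [MoeglinVignerasWaldspurger1987, Chap. 2 II.6, II.8] -/
theorem continuous_coeff_leviEquivSB {H : Type*} (ρ : Γ →* ((ι → F) ≃ₗ[F] (ι → F))) (hρ : ∀ u, Continuous fun γ => ρ γ u)
    (hρc : ∀ γ, Continuous (ρ γ)) (hρc' : ∀ γ, Continuous (ρ γ).symm) (B : SchwartzBruhat (ι → F) →ₗ[ℂ] (H → ℂ))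
    (Φ : SchwartzBruhat (ι → F)) (h : H) : Continuous fun γ : Γ => B (leviEquivSB (ρ γ) (hρc γ) (hρc' γ) Φ) h :=
  (isLocallyConstant_coeff_leviEquivSB ρ hρ hρc hρc' Φ fun Ψ => B Ψ h).continuous

omit [DecidableEq ι] in
/-- The scalar-valued form (`L : 𝒮(F^ι) →ₗ[ℂ] ℂ`, e.g. `ev_h ∘ B`, or ★ A2b's `ℓ`). [MoeglinVignerasWaldspurger1987, Chap. 2 II.8] -/
theorem continuous_coeff_leviEquivSB_apply (ρ : Γ →* ((ι → F) ≃ₗ[F] (ι → F))) (hρ : ∀ u, Continuous fun γ => ρ γ u)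
    (hρc : ∀ γ, Continuous (ρ γ)) (hρc' : ∀ γ, Continuous (ρ γ).symm) (L : SchwartzBruhat (ι → F) →ₗ[ℂ] ℂ) (Φ : SchwartzBruhat (ι → F)) :
    Continuous fun γ : Γ => L (leviEquivSB (ρ γ) (hρc γ) (hρc' γ) Φ) :=
  (isLocallyConstant_coeff_leviEquivSB ρ hρ hρc hρc' Φ L).continuous

omit [IsTopologicalGroup Γ] in
/-- The coefficient is constant near `1`: `∀ᶠ γ in 𝓝 1, B (leviEquivSB (ρ γ) Φ) h = B Φ h` (★ `eventually_leviOp_eq_self`).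
[MoeglinVignerasWaldspurger1987, Chap. 2 II.8] -/
theorem eventually_coeff_leviEquivSB_eq {H : Type*} (ρ : Γ →* ((ι → F) ≃ₗ[F] (ι → F))) (hρ : ∀ u, Continuous fun γ => ρ γ u)
    (hρc : ∀ γ, Continuous (ρ γ)) (hρc' : ∀ γ, Continuous (ρ γ).symm) (B : SchwartzBruhat (ι → F) →ₗ[ℂ] (H → ℂ))
    (Φ : SchwartzBruhat (ι → F)) (h : H) : ∀ᶠ γ in 𝓝 (1 : Γ), B (leviEquivSB (ρ γ) (hρc γ) (hρc' γ) Φ) h = B Φ h := by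
  filter_upwards [eventually_leviOp_eq_self ρ hρ Φ] with γ hγ
  have h1 : leviEquivSB (ρ γ) (hρc γ) (hρc' γ) Φ = Φ := (leviEquivSB_eq_self_iff (ρ γ) (hρc γ) (hρc' γ) Φ).2 hγ
  rw [h1]

end Summit.HodgeConjecture.HodgeConjecture.Cruxes.HLiu418.K2LiuLeviActionSmoothCoeff

end
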